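import Mathlib
import Summits.Ventures.PercRepro2.HCov
import Summits.Ventures.PercRepro2.HCovCubic
import Summits.Ventures.PercRepro2.TriDisagreement
import Summits.Ventures.PercRepro2.TriDisagreementPinned
import Summits.Ventures.PercRepro2.TypedSplit
import Summits.Ventures.PercRepro2.OneTypedEdge
import Summits.Ventures.PercRepro2.StarPattern
import Summits.Ventures.PercRepro2.StarFour

/-!
# The all-type-`1` degree-four star identity and DEG4 (blind cell PercRepro2, p1 g12; the
degree-4 sibling of the degree-3 star table, ASSIGNMENTS v12.27 (6′) / LEAD-CCW (c⁗⁗⁗) «degree 4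
in the multi-state language»)

Sorting the `81` placements of `typedCount_star4_split` (`StarFour.lean`) by the partition of the
four pieces over the copies, with the pendant singletons closed, gives the lead's identity

`N_(1,1,1,1) = B(Q₁) + 2 Σ_i B(T_i₁) + 2 Σ_p B(p₁) + Σ_{pairings {p, p̄}} Λ(p; p̄; ∅)`

(**`star4_1111`**; `3 + 24 + 36 + 18 = 81`): `Q` = the four-block, `T_i` = the four triples, `p` =
the six pairs (`B(P₁)` = `B4one P`, the block in one copy), and for each of the three perfect
matchings `{p, p̄}` of the labels the DISJOINT-PAIR ANTICHAIN LEAF `Λ(p; p̄; ∅)` = `Lam4 p p̄` (the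
two pairs in two distinct copies, six orderings) — the only signed terms. The candidate rule
**DEG4** (`Deg4`: the three antichain leaves are paid by the four triples,
`0 ≤ Σ_pairings Λ(p; p̄; ∅) + Σ_i B(T_i₁)`) and the pure bases one rung down (`Pure4`:
`0 ≤ B(P₁)` for every block) give `0 ≤ N_(1,1,1,1)` (**`typedCount_1111_nonneg_of_deg4`**).
Definitions only for `Deg4` / `Pure4`; no proof of either is claimed.
-/

namespace Summit.Ventures.PercRepro2

open CovForm CovForm.OneTyped CovForm.TypedRed

namespace StarFour

/-! ## The bases, the disjoint-pair leaves and the all-type-`1` identity -/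

section Identity

variable {V : Type*} {E : Type*} [Fintype E] [DecidableEq E] {R : Type*} [Field R]

/-- The typed set with the star removed. -/
abbrev F4 (F : Finset E) (s₁ s₂ s₃ s₄ : E) : Finset E := (((F.erase s₁).erase s₂).erase s₃).erase s₄

/-- The base configuration with the star pinned closed. -/
abbrev z4 (z : Config E) (s₁ s₂ s₃ s₄ : E) : Config E :=
  Function.update (Function.update (Function.update (Function.update z s₁ false) s₂ false) s₃
    false) s₄ false

/-- **The one-block base** `B(P₁)`: the block `P` open in exactly one copy (three placements). -/
noncomputable def B4one (ends : E → Sym2 V) (o a₁ a₂ a₃ b : V) (s₁ s₂ s₃ s₄ : E) (F₀ : Finset E)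
    (z₀ : Config E) (τ : E → ℕ) (P : Bool × Bool × Bool × Bool) : R :=
  patCount4 ends o a₁ a₂ a₃ b s₁ s₂ s₃ s₄ F₀ z₀ τ P (false, false, false, false)
      (false, false, false, false) +
    patCount4 ends o a₁ a₂ a₃ b s₁ s₂ s₃ s₄ F₀ z₀ τ (false, false, false, false) P
      (false, false, false, false) +
    patCount4 ends o a₁ a₂ a₃ b s₁ s₂ s₃ s₄ F₀ z₀ τ (false, false, false, false)
      (false, false, false, false) P

/-- **The two-block antichain leaf** `Λ(P; Q; ∅)`: the blocks `P`, `Q` in two distinct copies, the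
third copy closed (six orderings). For a perfect matching `{p, p̄}` of the labels this is the
disjoint-pair leaf `X(p, p̄)`. -/
noncomputable def Lam4 (ends : E → Sym2 V) (o a₁ a₂ a₃ b : V) (s₁ s₂ s₃ s₄ : E) (F₀ : Finset E)
    (z₀ : Config E) (τ : E → ℕ) (P Q : Bool × Bool × Bool × Bool) : R :=
  patCount4 ends o a₁ a₂ a₃ b s₁ s₂ s₃ s₄ F₀ z₀ τ P Q (false, false, false, false) +
    patCount4 ends o a₁ a₂ a₃ b s₁ s₂ s₃ s₄ F₀ z₀ τ P (false, false, false, false) Q +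
    patCount4 ends o a₁ a₂ a₃ b s₁ s₂ s₃ s₄ F₀ z₀ τ Q P (false, false, false, false) +
    patCount4 ends o a₁ a₂ a₃ b s₁ s₂ s₃ s₄ F₀ z₀ τ Q (false, false, false, false) P +
    patCount4 ends o a₁ a₂ a₃ b s₁ s₂ s₃ s₄ F₀ z₀ τ (false, false, false, false) P Q +
    patCount4 ends o a₁ a₂ a₃ b s₁ s₂ s₃ s₄ F₀ z₀ τ (false, false, false, false) Q P

variable {ends : E → Sym2 V} {o a₁ a₂ a₃ b : V} {s₁ s₂ s₃ s₄ : E} {y u₁ u₂ u₃ u₄ : V}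

open StarPattern in
/-- **The all-type-`1` degree-four star identity**:
`N_(1,1,1,1) = B(Q₁) + 2 Σ_i B(T_i₁) + 2 Σ_p B(p₁) + Σ_{pairings} Λ(p; p̄; ∅)` — the `81`
placements sorted by the partition of the four pieces over the copies (`3 + 24 + 36 + 18`), the
pendant singletons closed. -/
theorem star4_1111 (F : Finset E) (z : Config E) (τ : E → ℕ)
    (D : StarData4 ends o a₁ a₂ a₃ b s₁ s₂ s₃ s₄ y u₁ u₂ u₃ u₄ (F4 F s₁ s₂ s₃ s₄)
      (z4 z s₁ s₂ s₃ s₄))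
    (hs₁ : s₁ ∈ F) (hs₂ : s₂ ∈ F) (hs₃ : s₃ ∈ F) (hs₄ : s₄ ∈ F) (hτ₁ : τ s₁ = 1) (hτ₂ : τ s₂ = 1)
    (hτ₃ : τ s₃ = 1) (hτ₄ : τ s₄ = 1) :
    typedCount F z τ (K3 ends o a₁ a₂ a₃ b : Config E → Config E → Config E → R) =
      B4one ends o a₁ a₂ a₃ b s₁ s₂ s₃ s₄ (F4 F s₁ s₂ s₃ s₄) (z4 z s₁ s₂ s₃ s₄) τ
        (true, true, true, true) +
      2 * (B4one ends o a₁ a₂ a₃ b s₁ s₂ s₃ s₄ (F4 F s₁ s₂ s₃ s₄) (z4 z s₁ s₂ s₃ s₄) τ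
        (false, true, true, true) +
        B4one ends o a₁ a₂ a₃ b s₁ s₂ s₃ s₄ (F4 F s₁ s₂ s₃ s₄) (z4 z s₁ s₂ s₃ s₄) τ
        (true, false, true, true) +
        B4one ends o a₁ a₂ a₃ b s₁ s₂ s₃ s₄ (F4 F s₁ s₂ s₃ s₄) (z4 z s₁ s₂ s₃ s₄) τ
        (true, true, false, true) +
        B4one ends o a₁ a₂ a₃ b s₁ s₂ s₃ s₄ (F4 F s₁ s₂ s₃ s₄) (z4 z s₁ s₂ s₃ s₄) τ
        (true, true, true, false)) +
      2 * (B4one ends o a₁ a₂ a₃ b s₁ s₂ s₃ s₄ (F4 F s₁ s₂ s₃ s₄) (z4 z s₁ s₂ s₃ s₄) τ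
        (true, true, false, false) +
        B4one ends o a₁ a₂ a₃ b s₁ s₂ s₃ s₄ (F4 F s₁ s₂ s₃ s₄) (z4 z s₁ s₂ s₃ s₄) τ
        (true, false, true, false) +
        B4one ends o a₁ a₂ a₃ b s₁ s₂ s₃ s₄ (F4 F s₁ s₂ s₃ s₄) (z4 z s₁ s₂ s₃ s₄) τ
        (true, false, false, true) +
        B4one ends o a₁ a₂ a₃ b s₁ s₂ s₃ s₄ (F4 F s₁ s₂ s₃ s₄) (z4 z s₁ s₂ s₃ s₄) τ
        (false, true, true, false) +
        B4one ends o a₁ a₂ a₃ b s₁ s₂ s₃ s₄ (F4 F s₁ s₂ s₃ s₄) (z4 z s₁ s₂ s₃ s₄) τ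
        (false, true, false, true) +
        B4one ends o a₁ a₂ a₃ b s₁ s₂ s₃ s₄ (F4 F s₁ s₂ s₃ s₄) (z4 z s₁ s₂ s₃ s₄) τ
        (false, false, true, true)) +
      Lam4 ends o a₁ a₂ a₃ b s₁ s₂ s₃ s₄ (F4 F s₁ s₂ s₃ s₄) (z4 z s₁ s₂ s₃ s₄) τ
        (true, true, false, false) (false, false, true, true) +
      Lam4 ends o a₁ a₂ a₃ b s₁ s₂ s₃ s₄ (F4 F s₁ s₂ s₃ s₄) (z4 z s₁ s₂ s₃ s₄) τ
        (true, false, true, false) (false, true, false, true) +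
      Lam4 ends o a₁ a₂ a₃ b s₁ s₂ s₃ s₄ (F4 F s₁ s₂ s₃ s₄) (z4 z s₁ s₂ s₃ s₄) τ
        (true, false, false, true) (false, true, true, false) := by
  unfold F4 z4 at D ⊢
  rw [typedCount_star4_split ends o a₁ a₂ a₃ b D.h12 D.h13 D.h14 D.h23 D.h24 D.h34 F hs₁ hs₂ hs₃
    hs₄ z τ hτ₁ hτ₂ hτ₃ hτ₄]
  simp only [sum_placements]
  have e1 : IsSingle (true, false, false, false) := Or.inl rfl
  have e2 : IsSingle (false, true, false, false) := Or.inr (Or.inl rfl)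
  have e3 : IsSingle (false, false, true, false) := Or.inr (Or.inr (Or.inl rfl))
  have e4 : IsSingle (false, false, false, true) := Or.inr (Or.inr (Or.inr rfl))
  simp only [patCount4_close_x D τ e1, patCount4_close_x D τ e2, patCount4_close_x D τ e3,
    patCount4_close_x D τ e4, patCount4_close_y D τ _ e1, patCount4_close_y D τ _ e2,
    patCount4_close_y D τ _ e3, patCount4_close_y D τ _ e4, patCount4_close_w D τ _ _ e1,
    patCount4_close_w D τ _ _ e2, patCount4_close_w D τ _ _ e3, patCount4_close_w D τ _ _ e4]
  unfold B4one Lam4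
  ring

end Identity

/-! ## DEG4 as a named statement -/

section Deg4

variable {V : Type*} {E : Type*} [Fintype E] [DecidableEq E] {R : Type*} [Field R] [LinearOrder R]

/-- **The candidate rule DEG4** (LEAD-CCW (c⁗⁗⁗) «degree 4 in the multi-state language»): the three
disjoint-pair antichain leaves are paid by the four triples,
`0 ≤ Σ_{pairings} Λ(p; p̄; ∅) + Σ_i B(T_i₁)`. A definition only.
SCOPE (NEG-108): conjectured for the one-rung-down objects of GRAPHS — `(F₀, z₀, τ)` the typed
edges of `G − y`, `G` a finite graph (unmarked vertices allowed), the blocks the pieces of THIS star —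
and for the five-mark base; NOT for typed hypergraphs with unmarked vertices (`H*`: `N = −2`). -/
def Deg4 (ends : E → Sym2 V) (o a₁ a₂ a₃ b : V) (s₁ s₂ s₃ s₄ : E) (F₀ : Finset E) (z₀ : Config E)
    (τ : E → ℕ) : Prop :=
  0 ≤ Lam4 (R := R) ends o a₁ a₂ a₃ b s₁ s₂ s₃ s₄ F₀ z₀ τ (true, true, false, false)
      (false, false, true, true) +
    Lam4 ends o a₁ a₂ a₃ b s₁ s₂ s₃ s₄ F₀ z₀ τ (true, false, true, false)
      (false, true, false, true) +
    Lam4 ends o a₁ a₂ a₃ b s₁ s₂ s₃ s₄ F₀ z₀ τ (true, false, false, true)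
      (false, true, true, false) +
    (B4one ends o a₁ a₂ a₃ b s₁ s₂ s₃ s₄ F₀ z₀ τ (false, true, true, true) +
      B4one ends o a₁ a₂ a₃ b s₁ s₂ s₃ s₄ F₀ z₀ τ (true, false, true, true) +
      B4one ends o a₁ a₂ a₃ b s₁ s₂ s₃ s₄ F₀ z₀ τ (true, true, false, true) +
      B4one ends o a₁ a₂ a₃ b s₁ s₂ s₃ s₄ F₀ z₀ τ (true, true, true, false))

/-- **The pure bases one rung down**: every one-block base of the star's blocks is nonnegative
(row 2′TRI-H for the hypergraph `G − y + P₁`). A definition only.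
SCOPE (NEG-108): conjectured for the one-rung-down objects of GRAPHS — `(F₀, z₀, τ)` the typed
edges of `G − y`, `G` a finite graph (unmarked vertices allowed), the blocks the pieces of THIS star —
and for the five-mark base; NOT for typed hypergraphs with unmarked vertices (`H*`: `N = −2`). -/
def Pure4 (ends : E → Sym2 V) (o a₁ a₂ a₃ b : V) (s₁ s₂ s₃ s₄ : E) (F₀ : Finset E) (z₀ : Config E)
    (τ : E → ℕ) : Prop :=
  ∀ P : Bool × Bool × Bool × Bool, 0 ≤ B4one (R := R) ends o a₁ a₂ a₃ b s₁ s₂ s₃ s₄ F₀ z₀ τ P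

variable [IsStrictOrderedRing R] {ends : E → Sym2 V} {o a₁ a₂ a₃ b : V} {s₁ s₂ s₃ s₄ : E}
  {y u₁ u₂ u₃ u₄ : V}

/-- **Under DEG4 and the pure bases one rung down the all-type-`1` degree-four star is
nonnegative**: `N_(1,1,1,1) ≥ B(Q₁) + Σ_i B(T_i₁) + 2 Σ_p B(p₁) ≥ 0`. -/
theorem typedCount_1111_nonneg_of_deg4 (F : Finset E) (z : Config E) (τ : E → ℕ)
    (D : StarData4 ends o a₁ a₂ a₃ b s₁ s₂ s₃ s₄ y u₁ u₂ u₃ u₄ (F4 F s₁ s₂ s₃ s₄)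
      (z4 z s₁ s₂ s₃ s₄))
    (hs₁ : s₁ ∈ F) (hs₂ : s₂ ∈ F) (hs₃ : s₃ ∈ F) (hs₄ : s₄ ∈ F) (hτ₁ : τ s₁ = 1) (hτ₂ : τ s₂ = 1)
    (hτ₃ : τ s₃ = 1) (hτ₄ : τ s₄ = 1)
    (hD : Deg4 (R := R) ends o a₁ a₂ a₃ b s₁ s₂ s₃ s₄ (F4 F s₁ s₂ s₃ s₄) (z4 z s₁ s₂ s₃ s₄) τ)
    (hP : Pure4 (R := R) ends o a₁ a₂ a₃ b s₁ s₂ s₃ s₄ (F4 F s₁ s₂ s₃ s₄) (z4 z s₁ s₂ s₃ s₄) τ) :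
    0 ≤ typedCount F z τ (K3 ends o a₁ a₂ a₃ b : Config E → Config E → Config E → R) := by
  rw [star4_1111 F z τ D hs₁ hs₂ hs₃ hs₄ hτ₁ hτ₂ hτ₃ hτ₄]
  unfold Deg4 at hD
  have hQ := hP (true, true, true, true)
  have hT1 := hP (false, true, true, true)
  have hT2 := hP (true, false, true, true)
  have hT3 := hP (true, true, false, true)
  have hT4 := hP (true, true, true, false)
  have hp1 := hP (true, true, false, false)
  have hp2 := hP (true, false, true, false)
  have hp3 := hP (true, false, false, true)
  have hp4 := hP (false, true, true, false)
  have hp5 := hP (false, true, false, true)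
  have hp6 := hP (false, false, true, true)
  linarith

end Deg4

end StarFour

end Summit.Ventures.PercRepro2
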